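import Summits.Ventures.CertifiedArithmetic.LowPrec.SRPythagorasDescending
import HarnessLib

/-!
# Bits ≥ log₂(growth): the growth-factor form of the locality condition, every binary format

HONEST FRAMING: certified error envelopes and provably optimal rounding/accumulation schemes for
low-precision formats under stated cost models; every table by two implementations; no hardware or
vendor claims.

CVII (`SRPythagorasBoundedJump`) proved that the decidable `N`-binade locality condition `JumpLE`
makes StochasticA with `N` random bits drift-antitone (hence the Pythagorean law) on one-signed nested
windows; CVIII (`SRPythagorasDescending`) that nonpositive summands give `JumpLE` for every `N`.

THIS FILE states the condition in the form a user can check WITHOUT knowing the format's binade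
structure — a GROWTH FACTOR:

* `BelowLE F B x n t` / `GrowthLE F N x n s` (decidable): from every produced state `v` of the outcome
  tree, every later branch point (pre-rounding value) of `v`'s subtree is `≤ 2^N · v` — "the running
  sum never exceeds `2^N` times an earlier reached value".
* `gapLE_of_belowLE` — generic: a tree whose branch points stay `≤ B` meets only cells of points `≤ B`.
* `Format.shift_le_shift_add` — the binade shift grows by at most `N` under multiplication by `2^N`
  (`n' ≤ 2^N·n ⇒ shift n' ≤ shift n + N`); `binadeIdx_le_of_le_mul` — the same for `binadeIdx`.
* `valueSet_width_le_of_growth` — in `valueSet φ`, on a window `[lo, hi]` with `0 ≤ lo`: a point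
  `c ≤ 2^N·v` (`v` a window value, `a` any window value above `v`) has cell width `≤ 2^N·(a − v)`.
* `valueSet_jumpLE_of_growthLE` — **`GrowthLE N ⇒ JumpLE N`** on every one-signed window of every
  format; hence `valueSet_stochasticA_of_growthLE`: drift-antitone and
  `E(ŝₙ − sₙ)² ≤ n·G²/4 + (n·2^{-N}·G)²` with `G = 2^{binadeIdx hi}·quantum`, for every `N`:
  **bits ≥ log₂(growth factor after the first rounding)** suffice, whatever the number of binades the
  window spans below the first rounding (the start value is exempt: it is not a produced state);
  E3M2 form `Formats.e3m2_stochasticA_of_growthLE` (every window, `G = 2^{binadeIdx hi}/16`).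
* E3M2 kernel instances (`decide`): `Formats.e3m2_growth_twoBits` — from `ŝ₀ = 0`, summands
  `15/8, 5/4, 3/4, 7/4, 3/8`: roundings in the three binades `[1,2), [2,4), [4,8)` (tight window
  `[7/4, 8]`, `J = 3`), growth factor `≤ 4` from every produced state, so TWO bits give
  drift-antitonicity and the law where §4y (XCIV) asks for three; `Formats.e3m2_jumpLE_not_growthLE` —
  `GrowthLE` is strictly stronger than `JumpLE` (CVII's four-binade two-bit tree has `JumpLE`, not
  `GrowthLE 2`).  HONEST SIZE OF THE GAIN: growth `2^N` from a state in binade `i` reaches binade `i + N`,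
  so a `GrowthLE N` tree spans at most `N + 1` binades above its first produced state (plus any depth
  BELOW it for the exempt start): one bit fewer than XCIV's `J`, and a criterion that needs no spacing
  table.  Certificate `certs/sr/gen19/growth` (two implementations).

Scope: sufficient conditions only (growth ⇒ locality ⇒ antitone ⇒ law); positive windows (mirror
images by XCVI as in CVIII); the (a′) statement for all trees with `2 ≤ N < J` stays open.
-/

namespace Literature.ComputerArithmetic.FloatingPoint.Format

variable (φ : Format)

/-- **Doubling raises the binade shift by at most one**: `n' ≤ 2^N·n ⇒ shift n' ≤ shift n + N`.
[folklore] -/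
theorem shift_le_shift_add {n n' N : ℕ} (h : n' ≤ 2 ^ N * n) : φ.shift n' ≤ φ.shift n + N := by
  by_cases hc : φ.emaxCode - 1 ≤ φ.shift n + N
  · exact (φ.shift_le n').trans hc
  · have hlt : φ.shift n < φ.emaxCode - 1 := by omega
    have h1 := Format.lt_pow_shift hlt
    apply Format.shift_le_of_lt_pow
    calc n' ≤ 2 ^ N * n := h
      _ < 2 ^ N * 2 ^ (φ.manBits + 1 + φ.shift n) := Nat.mul_lt_mul_of_pos_left h1 (by positivity)
      _ = 2 ^ (φ.manBits + 1 + (φ.shift n + N)) := by rw [← pow_add]; ring_nf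

end Literature.ComputerArithmetic.FloatingPoint.Format

namespace Summit.Ventures.CertifiedArithmetic.LowPrec.SR

open Literature.ComputerArithmetic.ConnollyHighamMary2021
open Finset

variable {K : Type*} [Field K] [LinearOrder K] [IsStrictOrderedRing K] [FloorRing K]

namespace LimitedBits

/-! ### The growth predicate -/

/-- `BelowLE F B x n t`: every branch point (pre-rounding value `state + summand`) of the outcome tree
from `t` is `≤ B`. -/
def BelowLE (F : Finset K) (B : K) : (ℕ → K) → ℕ → K → Prop
  | _, 0, _ => True
  | x, n + 1, t => t + x 0 ≤ B ∧ BelowLE F B (fun i => x (i + 1)) n (up F (t + x 0))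
      ∧ BelowLE F B (fun i => x (i + 1)) n (dn F (t + x 0))

/-- Boolean evaluator of `BelowLE`. -/
def belowLEB (F : Finset K) (B : K) : (ℕ → K) → ℕ → K → Bool
  | _, 0, _ => true
  | x, n + 1, t => decide (t + x 0 ≤ B) && belowLEB F B (fun i => x (i + 1)) n (up F (t + x 0))
      && belowLEB F B (fun i => x (i + 1)) n (dn F (t + x 0))

omit [IsStrictOrderedRing K] [FloorRing K] in
/-- `belowLEB` computes `BelowLE`. -/
theorem belowLEB_iff (F : Finset K) (B : K) (x : ℕ → K) (n : ℕ) (t : K) :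
    belowLEB F B x n t = true ↔ BelowLE F B x n t := by
  induction n generalizing x t with
  | zero => simp [belowLEB, BelowLE]
  | succ n ih => simp only [belowLEB, BelowLE, Bool.and_eq_true, decide_eq_true_eq, ih, and_assoc]

/-- `GrowthLE F N x n s`: from every PRODUCED state `v` (either candidate of any branch point) every
later branch point of `v`'s subtree is `≤ 2^N · v` — the running sum never exceeds `2^N` times an earlier
reached value.  The start `s` is exempt. -/
def GrowthLE (F : Finset K) (N : ℕ) : (ℕ → K) → ℕ → K → Prop
  | _, 0, _ => True
  | x, n + 1, s =>
      BelowLE F (2 ^ N * dn F (s + x 0)) (fun i => x (i + 1)) n (dn F (s + x 0))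
      ∧ BelowLE F (2 ^ N * up F (s + x 0)) (fun i => x (i + 1)) n (up F (s + x 0))
      ∧ GrowthLE F N (fun i => x (i + 1)) n (up F (s + x 0))
      ∧ GrowthLE F N (fun i => x (i + 1)) n (dn F (s + x 0))

/-- Boolean evaluator of `GrowthLE`. -/
def growthLEB (F : Finset K) (N : ℕ) : (ℕ → K) → ℕ → K → Bool
  | _, 0, _ => true
  | x, n + 1, s =>
      belowLEB F (2 ^ N * dn F (s + x 0)) (fun i => x (i + 1)) n (dn F (s + x 0))
      && belowLEB F (2 ^ N * up F (s + x 0)) (fun i => x (i + 1)) n (up F (s + x 0))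
      && growthLEB F N (fun i => x (i + 1)) n (up F (s + x 0))
      && growthLEB F N (fun i => x (i + 1)) n (dn F (s + x 0))

omit [IsStrictOrderedRing K] [FloorRing K] in
/-- `growthLEB` computes `GrowthLE`. -/
theorem growthLEB_iff (F : Finset K) (N : ℕ) (x : ℕ → K) (n : ℕ) (s : K) :
    growthLEB F N x n s = true ↔ GrowthLE F N x n s := by
  induction n generalizing x s with
  | zero => simp [growthLEB, GrowthLE]
  | succ n ih => simp only [growthLEB, GrowthLE, Bool.and_eq_true, belowLEB_iff, ih, and_assoc]

/-- `GrowthLE` is decidable (by `growthLEB`). -/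
instance instDecidableGrowthLE (F : Finset K) (N : ℕ) (x : ℕ → K) (n : ℕ) (s : K) :
    Decidable (GrowthLE F N x n s) :=
  decidable_of_iff _ (growthLEB_iff F N x n s)

omit [IsStrictOrderedRing K] [FloorRing K] in
/-- A tree confined to `[lo, hi]` (no saturation) whose branch points stay `≤ B` meets only cells of
window points `≤ B`: a width bound for those cells is a `GapLE` bound for the tree. -/
theorem gapLE_of_belowLE {F : Finset K} {lo hi B G : K}
    (hG : ∀ c, lo ≤ c → c ≤ hi → c ≤ B → up F c - dn F c ≤ G) :
    ∀ (x : ℕ → K) (n : ℕ) (t : K), NoSat F x n t → InWindow F lo hi x n t → BelowLE F B x n t →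
      GapLE F G x n t := by
  intro x n
  induction n generalizing x with
  | zero => intro t _ _ _; trivial
  | succ n ih =>
    rintro t ⟨hin, hnu, hnd⟩ ⟨⟨h1, h2⟩, hwu, hwd⟩ ⟨hb, hbu, hbd⟩
    rw [clamp_eq_self hin] at h1 h2
    refine ⟨?_, ih _ _ hnu hwu hbu, ih _ _ hnd hwd hbd⟩
    show up F (t + x 0) - dn F (t + x 0) ≤ G
    exact hG _ h1 h2 hb

/-! ### Every binary format: growth ⇒ locality -/

section Formats

open Literature.ComputerArithmetic.FloatingPoint (Format MiniFloat)
open Literature.ComputerArithmetic.FloatingPoint.MiniFloat (valueSet valueSet_nonempty)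

/-- `c ≤ 2^N · v` for a nonnegative value `v` of `φ` ⇒ `binadeIdx c ≤ binadeIdx v + N`. -/
theorem binadeIdx_le_of_le_mul (φ : Format) {v c : ℚ} (hv : v ∈ valueSet φ) (h0 : 0 ≤ v) {N : ℕ}
    (hc : c ≤ 2 ^ N * v) : binadeIdx φ c ≤ binadeIdx φ v + N := by
  have hq := φ.quantum_pos
  obtain ⟨nv, -, -, ev, sv⟩ := exists_natMul_of_mem hv h0
  rw [sv]
  unfold binadeIdx
  apply Format.shift_le_shift_add
  have h1 : c / φ.quantum ≤ 2 ^ N * nv := by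
    rw [div_le_iff₀ hq, mul_assoc, ← ev]; exact hc
  have h2 : ⌊c / φ.quantum⌋ ≤ ((2 ^ N * nv : ℕ) : ℤ) := by
    have : (⌊c / φ.quantum⌋ : ℚ) ≤ ((2 ^ N * nv : ℕ) : ℚ) := by
      push_cast; exact (Int.floor_le _).trans h1
    exact_mod_cast this
  have h3 := Int.toNat_le_toNat h2
  rwa [Int.toNat_natCast] at h3

/-- **Width bound under growth.**  On a window `[lo, hi]` of `valueSet φ` with `0 ≤ lo`: for window
values `v < a` and a window point `c ≤ 2^N·v`, the cell of `c` has width `≤ 2^N·(a − v)`. -/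
theorem valueSet_width_le_of_growth (φ : Format) {lo hi : ℚ} (hlo : lo ∈ valueSet φ)
    (hhi : hi ∈ valueSet φ) (h0 : 0 ≤ lo) {v a c : ℚ} (hv : v ∈ valueSet φ) (hlv : lo ≤ v)
    (ha : a ∈ valueSet φ) (hva : v < a) (hah : a ≤ hi) (h1 : lo ≤ c) (h2 : c ≤ hi) {N : ℕ}
    (hc : c ≤ 2 ^ N * v) :
    up (valueSet φ) c - dn (valueSet φ) c ≤ 2 ^ N * (a - v) := by
  have hq := φ.quantum_pos
  have hW := valueSet_nestedWindow φ hlo hhi h0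
  set g : ℚ := 2 ^ binadeIdx φ lo * φ.quantum with hg
  have hgpos : 0 < g := hW.pos
  have hhimax : hi ≤ φ.maxRat := by
    obtain ⟨y, rfl⟩ := MiniFloat.mem_valueSet.mp hhi
    exact (le_abs_self _).trans (MiniFloat.abs_toRat_le_maxRat y)
  -- the gap at a window point is `0` or the local spacing
  have hgap : ∀ d, lo ≤ d → d ≤ hi → up (valueSet φ) d - dn (valueSet φ) d = 0 ∨
      up (valueSet φ) d - dn (valueSet φ) d = 2 ^ binadeIdx φ d * φ.quantum := by
    intro d hd1 hd2
    have hcl : clamp (valueSet φ) d = d := clamp_eq_self ⟨⟨lo, hlo, hd1⟩, ⟨hi, hhi, hd2⟩⟩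
    unfold up dn; rw [hcl]
    exact valueSet_gap_zero_or_spacing φ (h0.trans hd1) (hd2.trans hhimax)
  -- successor cell of `v`: `[v, v⁺]` with `v⁺ − v ≥ 2^{binadeIdx v}·q` and `a − v ≥ v⁺ − v`
  obtain ⟨i, z, -, humF, hvum, humhi, hwi, hz⟩ := hW.succ_spacing hv hlv ha hva hah
  have h2ig : (0 : ℚ) < 2 ^ i * g := by positivity
  have hz1 : (1 : ℤ) ≤ z := by
    have hzK : (0 : ℚ) < (z : ℚ) := by
      by_contra hneg
      have hle : (z : ℚ) ≤ 0 := not_lt.mp hneg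
      have : (z : ℚ) * (2 ^ i * g) ≤ 0 := mul_nonpos_of_nonpos_of_nonneg hle h2ig.le
      linarith
    have : (0 : ℤ) < z := by exact_mod_cast hzK
    omega
  have hav : up (valueSet φ) (v + g / 2) - v ≤ a - v := by
    have : (1 : ℚ) ≤ (z : ℚ) := by exact_mod_cast hz1
    rw [hwi]; nlinarith
  set m : ℚ := v + g / 2 with hm
  have hsep : v + g ≤ a := hW.add_le_of_lt hv ha hlv hva hah
  have hm1 : lo ≤ m := by linarith
  have hm2 : m ≤ hi := by linarith
  obtain ⟨hdmF, -, -, -, hdmm, -⟩ := hW.cand hm1 hm2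
  have hdm : dn (valueSet φ) m = v := by
    refine le_antisymm ?_ (le_dn_of_mem hv (by linarith))
    rcases le_or_gt (dn (valueSet φ) m) v with hle | hlt
    · exact hle
    · have := hW.add_le_of_lt hv hdmF hlv hlt (hdmm.trans hm2)
      linarith
  -- width of the successor cell = local spacing at `m ≥ v`, hence `≥ 2^{binadeIdx v}·q`
  have hsucc : 2 ^ binadeIdx φ v * φ.quantum ≤ up (valueSet φ) m - v := by
    rcases hgap m hm1 hm2 with h0w | hsp
    · exfalso; rw [hdm] at h0w; linarith
    · rw [hdm] at hsp; rw [hsp]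
      exact mul_le_mul_of_nonneg_right
        (pow_le_pow_right₀ (by norm_num) (binadeIdx_mono φ (by linarith))) hq.le
  -- width of the cell of `c`
  have hv0 : 0 ≤ v := h0.trans hlv
  rcases hgap c h1 h2 with h0w | hsp
  · rw [h0w]; exact mul_nonneg (by positivity) (by linarith)
  · rw [hsp]
    have hidx := binadeIdx_le_of_le_mul φ hv hv0 hc
    calc (2 : ℚ) ^ binadeIdx φ c * φ.quantum
        ≤ 2 ^ (binadeIdx φ v + N) * φ.quantum :=
          mul_le_mul_of_nonneg_right (pow_le_pow_right₀ (by norm_num) hidx) hq.le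
      _ = 2 ^ N * (2 ^ binadeIdx φ v * φ.quantum) := by rw [pow_add]; ring
      _ ≤ 2 ^ N * (up (valueSet φ) m - v) := mul_le_mul_of_nonneg_left hsucc (by positivity)
      _ ≤ 2 ^ N * (a - v) := mul_le_mul_of_nonneg_left hav (by positivity)

/-- **Growth ⇒ locality, every format.**  On a window `[lo, hi]` of `valueSet φ` with `0 ≤ lo`, a tree
with `GrowthLE N` (no saturation, confined to the window) satisfies the `N`-binade locality condition
`JumpLE`. -/
theorem valueSet_jumpLE_of_growthLE (φ : Format) {lo hi : ℚ} (hlo : lo ∈ valueSet φ)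
    (hhi : hi ∈ valueSet φ) (h0 : 0 ≤ lo) (N : ℕ) :
    ∀ (x : ℕ → ℚ) (n : ℕ) (s : ℚ), NoSat (valueSet φ) x n s → InWindow (valueSet φ) lo hi x n s →
      GrowthLE (valueSet φ) N x n s → JumpLE (valueSet φ) hi N x n s := by
  have hW := valueSet_nestedWindow φ hlo hhi h0
  intro x n
  induction n generalizing x with
  | zero => intro s _ _ _; trivial
  | succ n ih =>
    rintro s ⟨hin, hnu, hnd⟩ ⟨⟨h1, h2⟩, hwu, hwd⟩ ⟨hbd, hbu, hgu, hgd⟩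
    rw [clamp_eq_self hin] at h1 h2
    obtain ⟨hdF, huF, hlod, -, -, hcu⟩ := hW.cand h1 h2
    have key : ∀ v : ℚ, v ∈ valueSet φ → lo ≤ v → NoSat (valueSet φ) (fun i => x (i + 1)) n v →
        InWindow (valueSet φ) lo hi (fun i => x (i + 1)) n v →
        BelowLE (valueSet φ) (2 ^ N * v) (fun i => x (i + 1)) n v →
        ∀ a ∈ valueSet φ, v < a → a ≤ hi →
          GapLE (valueSet φ) (2 ^ N * (a - v)) (fun i => x (i + 1)) n v := by
      intro v hv hlv hnv hwv hbv a ha hva hah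
      exact gapLE_of_belowLE
        (fun c hc1 hc2 hcB => valueSet_width_le_of_growth φ hlo hhi h0 hv hlv ha hva hah hc1 hc2 hcB)
        _ _ _ hnv hwv hbv
    exact ⟨key _ hdF hlod hnd hwd hbd, key _ huF (h1.trans hcu) hnu hwu hbu, ih _ _ hnu hwu hgu,
      ih _ _ hnd hwd hgd⟩

/-- **Bits ≥ log₂(growth), every format.**  For values `0 ≤ lo ≤ hi` of `φ` and ANY `N`: a
StochasticA tree confined to `[lo, hi]` (no saturation) whose running sum never exceeds `2^N` times an
earlier reached value (`GrowthLE N`) is drift-antitone and obeys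
`E(ŝₙ − sₙ)² ≤ n·G²/4 + (n·2^{-N}·G)²` with `G = 2^{binadeIdx hi}·quantum` — however many binades the
window spans. -/
theorem valueSet_stochasticA_of_growthLE (φ : Format) {lo hi : ℚ} (hlo : lo ∈ valueSet φ)
    (hhi : hi ∈ valueSet φ) (h0 : 0 ≤ lo) (hle : lo ≤ hi) (N : ℕ) (x : ℕ → ℚ) (n : ℕ) (s : ℚ)
    (hns : NoSat (valueSet φ) x n s) (hw : InWindow (valueSet φ) lo hi x n s)
    (hg : GrowthLE (valueSet φ) N x n s) :
    DriftAntitone (valueSet φ) (probAwayA N) x n s ∧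
      accExpQ (valueSet φ) (probAwayA N) x n (fun t => (t - (s + ∑ i ∈ range n, x i)) ^ 2) s
        ≤ n * ((2 ^ binadeIdx φ hi * φ.quantum) ^ 2 / 4)
          + (n * (1 / 2 ^ N * (2 ^ binadeIdx φ hi * φ.quantum))) ^ 2 := by
  have hW := valueSet_nestedWindow φ hlo hhi h0
  have hj := valueSet_jumpLE_of_growthLE φ hlo hhi h0 N x n s hns hw hg
  have h : DriftAntitone (valueSet φ) (probAwayA N) x n s ∧
      accExpQ (valueSet φ) (probAwayA N) x n (fun t => (t - (s + ∑ i ∈ range n, x i)) ^ 2) s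
        ≤ n * ((2 ^ (binadeIdx φ hi - binadeIdx φ lo) * (2 ^ binadeIdx φ lo * φ.quantum)) ^ 2 / 4)
          + (n * (1 / 2 ^ N * (2 ^ (binadeIdx φ hi - binadeIdx φ lo)
              * (2 ^ binadeIdx φ lo * φ.quantum)))) ^ 2 :=
    ⟨hW.driftAntitone_stochasticA_of_jumpLE h0 N x n s hns hw hj,
      hW.stochasticA_acc_sq_le_of_jumpLE h0 N x n s hns hw hj⟩
  have e : (2 : ℚ) ^ (binadeIdx φ hi - binadeIdx φ lo) * (2 ^ binadeIdx φ lo * φ.quantum)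
      = 2 ^ binadeIdx φ hi * φ.quantum := by
    rw [← mul_assoc, ← pow_add, Nat.sub_add_cancel (binadeIdx_mono φ hle)]
  rwa [e] at h

end Formats

end LimitedBits

/-! ### E3M2 kernel instances -/

namespace Formats

open LimitedBits
open Literature.ComputerArithmetic.FloatingPoint (Format)
open Literature.ComputerArithmetic.FloatingPoint.MiniFloat (valueSet)

/-- **E3M2, every window, every `N`: bits ≥ log₂(growth).**  On any window `[lo, hi]` of E3M2 values
with `0 ≤ lo`, a StochasticA tree with `GrowthLE N` (no saturation, confined to the window) is
drift-antitone and obeys the law with `G = 2^{binadeIdx hi}/16`. -/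
theorem e3m2_stochasticA_of_growthLE {lo hi : ℚ} (hlo : lo ∈ e3m2) (hhi : hi ∈ e3m2) (h0 : 0 ≤ lo)
    (hle : lo ≤ hi) (N : ℕ) (x : ℕ → ℚ) (n : ℕ) (s : ℚ) (hns : NoSat e3m2 x n s)
    (hw : InWindow e3m2 lo hi x n s) (hg : GrowthLE e3m2 N x n s) :
    DriftAntitone e3m2 (probAwayA N) x n s ∧
      accExpQ e3m2 (probAwayA N) x n (fun t => (t - (s + ∑ i ∈ range n, x i)) ^ 2) s
        ≤ n * ((2 ^ binadeIdx Format.E3M2 hi * (1 / 16 : ℚ)) ^ 2 / 4)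
          + (n * (1 / 2 ^ N * (2 ^ binadeIdx Format.E3M2 hi * (1 / 16 : ℚ)))) ^ 2 := by
  have hq : Format.E3M2.quantum = 1 / 16 := by decide +kernel
  rw [e3m2_eq_valueSet] at hlo hhi hns hw hg ⊢
  rw [← hq]
  exact valueSet_stochasticA_of_growthLE Format.E3M2 hlo hhi h0 hle N x n s hns hw hg

/-- **E3M2, two bits, three binades, accumulating from zero** (`decide`): summands
`15/8, 5/4, 3/4, 7/4, 3/8` from `ŝ₀ = 0`; the roundings happen in the binades `[1,2)`, `[2,4)`, `[4,8)`
(tight window `[7/4, 8]`, `J = 3`, so §4y (XCIV) asks for THREE bits), but after the first rounding the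
running sum never exceeds `4×` an earlier reached value: `GrowthLE 2` holds, hence (`decide`, and by
`valueSet_stochasticA_of_growthLE`) `JumpLE`, drift-antitonicity and the law with TWO bits: `E(ŝ₅ − s₅)² ≤ 5·2²/4 + (5·2/4)² = 45/4`
(`G = 2^{binadeIdx 8}·(1/16) = 2`; the exact value is `17/32`, certificate gen19/jump). -/
theorem e3m2_growth_twoBits :
    NoSat e3m2 (seqL [15 / 8, 5 / 4, 3 / 4, 7 / 4, 3 / 8]) 5 0
    ∧ InWindow e3m2 (7 / 4) 8 (seqL [15 / 8, 5 / 4, 3 / 4, 7 / 4, 3 / 8]) 5 0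
    ∧ GrowthLE e3m2 2 (seqL [15 / 8, 5 / 4, 3 / 4, 7 / 4, 3 / 8]) 5 0
    ∧ DriftAntitone e3m2 (probAwayA 2) (seqL [15 / 8, 5 / 4, 3 / 4, 7 / 4, 3 / 8]) 5 0
    ∧ accExpQ e3m2 (probAwayA 2) (seqL [15 / 8, 5 / 4, 3 / 4, 7 / 4, 3 / 8]) 5
        (fun t => (t - (0 + ∑ i ∈ range 5, seqL [15 / 8, 5 / 4, 3 / 4, 7 / 4, 3 / 8] i)) ^ 2) 0
      ≤ 5 * ((2 : ℚ) ^ 2 / 4) + (5 * (1 / 2 ^ 2 * (2 : ℚ))) ^ 2 := by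
  have hns : NoSat e3m2 (seqL [15 / 8, 5 / 4, 3 / 4, 7 / 4, 3 / 8]) 5 0 := by
    rw [← noSatB_iff]; decide +kernel
  have hw : InWindow e3m2 (7 / 4) 8 (seqL [15 / 8, 5 / 4, 3 / 4, 7 / 4, 3 / 8]) 5 0 := by
    rw [← inWindowB_iff]; decide +kernel
  have hg : GrowthLE e3m2 2 (seqL [15 / 8, 5 / 4, 3 / 4, 7 / 4, 3 / 8]) 5 0 := by
    rw [← growthLEB_iff]; decide +kernel
  have h := e3m2_stochasticA_of_growthLE (by decide +kernel) (by decide +kernel) (by norm_num)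
    (by norm_num) 2 _ 5 0 hns hw hg
  have h5 : binadeIdx Format.E3M2 8 = 5 := by decide +kernel
  rw [h5] at h
  exact ⟨hns, hw, hg, h.1, h.2.trans (le_of_eq (by norm_num))⟩

/-- **`GrowthLE` is strictly stronger than `JumpLE`** (`decide`): the four-binade two-bit tree of CVII
(`e3m2_fourBinade_twoBits`: from `2`, summands `7/4, 37/16, 3/2, 11/4, 11/4`) satisfies `JumpLE` with
`N = 2` but NOT `GrowthLE 2` (its all-up path grows from the produced state `4` to the branch point
`67/4 > 16`): exact landings and coarse cells high up cost nothing under `JumpLE`, while the growth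
factor ignores them. -/
theorem e3m2_jumpLE_not_growthLE :
    JumpLE e3m2 28 2 (seqL [7 / 4, 37 / 16, 3 / 2, 11 / 4, 11 / 4]) 5 2
    ∧ ¬ GrowthLE e3m2 2 (seqL [7 / 4, 37 / 16, 3 / 2, 11 / 4, 11 / 4]) 5 2 := by
  refine ⟨?_, ?_⟩
  · rw [← jumpLEB_iff]; decide +kernel
  · rw [← growthLEB_iff]; decide +kernel

end Formats

end Summit.Ventures.CertifiedArithmetic.LowPrec.SR
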